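import Literature.Geometry.Lorentzian.InitialData
import Literature.Geometry.Lorentzian.KerrConvergence
import Literature.Geometry.Riemannian.InjectivityRadius
import Literature.Geometry.Riemannian.IsotropicCurvature
import Literature.Geometry.Lorentzian.HypersurfaceRestriction
import HarnessLib

/-!
# Bounded geometry at scale `Λ⁻¹`: initial data sets, and spacetime slabs in a late-time chart
(topic `Geometry/Lorentzian`; definition item `defn-HasBoundedGeometry`, wanted by route
`FinalStateConjecture/NoParkingWithoutHorizon`, definition request D3)

Two HYPOTHESIS predicates formalising the phrase "bounded geometry at (unit) scale `Λ⁻¹`" of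
Cheeger–Gromov compactness theory as it is used in mathematical general relativity
(Anderson, *Cheeger–Gromov theory and applications to general relativity* (2004), §2 and §5;
Anderson, CMP 222 (2001), Rem. 1.6 (ii)–(iii); Anderson, AHP 1 (2000), Lemmas 1.3–1.4 and
Thm. 0.2; Klainerman–Rodnianski–Szeftel, Invent. Math. 202 (2015) = arXiv:1204.1767, Thm. 2.2
and Thm. 2.10, whose hypotheses `‖R‖_{L²(Σ₀)}`, `‖k‖_{L²} + ‖∇k‖_{L²}`, `r_vol(Σ₀, 1) ≥ 1/2` are
the `L²` version of the pointwise triple used here; Lee for the injectivity radius):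

* **(i) initial data sets.** `InitialDataSet.HasBoundedGeometryOn D U Λ` (and the global
  `InitialDataSet.HasBoundedGeometry D Λ := … univ Λ`) for a smooth initial data set
  `D = (h, k)` on `X` (`InitialData.lean`): `0 < Λ` and, at every point `x ∈ U`,
  - `|Rm_h| ≤ Λ²` in the frame sense of the tree (`|Rm(X₁,X₂,X₃,X₄)| ≤ Λ²` for `h`-unit-bounded
    vectors; verbatim the clause of `Literature.Geometry.Riemannian.CurvatureBoundedBy` /
    `CurvatureBoundedOn`, see `HasBoundedGeometry.curvatureBoundedBy` in
    `InitialDataCurvatureBound.lean`),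
  - `|∇k| ≤ Λ²` in the same frame sense (`∇k = D.metric.covDeriv₂ D.k`, `LeviCivita.lean`),
  - `|k|²_h ≤ Λ²` (`D.normSqK`, the `h`-trace norm of `InitialData.lean`),
  - `inj_h(x) ≥ Λ⁻¹` (`Literature.Geometry.Riemannian.injectivityRadius`, Lee 2018, p. 165).
  This is the requested "`|Riem_h| + |∇k| + |k|² ≤ Λ²` pointwise and injectivity radius
  `≥ Λ⁻¹`": the three separate bounds are equivalent to the single bound on the sum up to a factor
  `3`, and frame-wise sup bounds are equivalent to bounds on the `h`-norms of the tensors up to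
  dimensional constants (all norms on the finite-dimensional spaces of `3`- and `4`-tensors over an
  inner product space are equivalent; cf. the docstring of `CurvatureBoundedBy` and
  `curvNormSqWith_le_of_curvatureBoundedBy` / `curvatureBoundedBy_of_curvNormSqWith_le` in
  `Riemannian/CurvatureNormSq.lean`). For a slice `(X, h, k)` of a VACUUM spacetime with unit
  normal `T`, the Gauss and Codazzi equations and `Ric(g) = 0` express every component of the
  space-time curvature `R` in a `T`-adapted orthonormal frame as a polynomial in `Rm_h`, `∇k` and
  `k ∗ k`, so the three bounds give Anderson's frame bound `|R|_T ≤ C Λ²` (Anderson 2004, (5.3),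
  (5.5)) on the slice, and in addition control its extrinsic curvature (which `|R|_T` alone does
  not: a wiggly slice of Minkowski space has `R = 0` and large `k`). All four quantities scale
  like `Λ` under
  `(h, k) ↦ (μ² h, μ k)`, `Λ ↦ Λ/μ` — "bounded geometry at scale `Λ⁻¹`" (Anderson 2004, (1.1) and
  §2: curvature bound plus injectivity/volume radius bound is the hypothesis of Cheeger–Gromov
  convergence, Thm. 2.2 `|Ric| ≤ k, inj ≥ i₀`; Anderson 2001, Rem. 1.6 (ii): under `|Rm| ≤ Λ` a
  lower volume bound of unit balls is equivalent to a lower bound on the injectivity radius;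
  Anderson 2000, (1.9)–(1.10)). The harmonic-radius variant (Anderson 2004, Def. 2.1; Anderson
  2001, Rem. 1.6 (iii), (1.29)–(1.30)) is NOT vendored: the tree has no harmonic coordinates;
  under the curvature bound `inj ≥ Λ⁻¹` implies a lower bound on the `C^{1,β}`/`L^{2,p}` harmonic
  radius (Anderson 2004, (2.4) in the proof of Thm. 2.2; Anderson 2001, Rem. 1.6 (iii); Anderson
  2000, p. 5, "Cheeger's lemma" for the converse direction volume ⇒ `inj`), so the
  injectivity-radius form is the stronger (safer) hypothesis.
* **(ii) spacetime slabs in a late-time chart.** Over the vocabulary of `KerrConvergence.lean`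
  (reference background `B : ModelBackground` in a global chart of `E4`, chart map
  `Ψ : B.domain → 𝓢.carrier` into a spacetime `𝓢 : Spacetime 4`, `Cᵏ` sup norms `supCkENorm`):
  `Spacetime.chartMetric 𝓢 B Ψ x = (Ψ^* g)(x)` — the pulled-back metric components in the chart
  (so that `Spacetime.deviation = chartMetric − B.bilin`, `deviation_eq_chartMetric_sub`),
  `Spacetime.chartMetricCk 𝓢 B Ψ k S` — its `Cᵏ` sup norm over `S ⊆ B.domain`, and the predicate
  `Spacetime.HasBoundedGeometryOn 𝓢 B Ψ S Λ`: `0 < Λ`, the components `Ψ^* g` are `C²` on the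
  (open) chart domain, `‖∂^m (Ψ^* g)‖ ≤ Λ` on `S` for `m ≤ 2`, the coordinate time vector `∂₀`
  is uniformly timelike, `(Ψ^* g)(∂₀, ∂₀) ≤ −Λ⁻¹`, and the coordinate slices `{x⁰ = const}` are
  uniformly spacelike, `(Ψ^* g)(v, v) ≥ Λ⁻¹ ‖v‖²` for `v⁰ = 0`, on `S`. The slab version
  `Spacetime.HasBoundedSlabGeometry 𝓢 B Ψ τ L R Λ` is the case
  `S = B.truncTimeBand τ L R = {τ ≤ t ≤ τ + L} ∩ {r ≤ R}`. This is the coordinate ("harmonic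
  radius"-type) face of bounded geometry: Anderson 2004, Def. 2.1 (control
  `c₀⁻¹ δ ≤ g_{αβ} ≤ c₀ δ` of the components as bilinear forms plus bounds on `∂ᵏ g_{αβ}` in a
  chart of definite size) and §5, (5.3)–(5.6) with Thm. 5.1 (for Lorentz metrics the size of
  `R`, `g_{αβ}` is measured after choosing a unit timelike `T`, equivalently the Riemannian
  `g_E = g + 2 T ⊗ T`; the conclusion of the regularity theorem is exactly "coordinate charts on
  cylinders `B_p(r₀) × [−r₀, r₀]` in which the full space-time components `g_{αβ}` are controlled
  up to order 2"). The two cone conditions are the Lorentzian replacement of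
  `c₀⁻¹ δ ≤ g_{αβ} ≤ c₀ δ`: together with the `C⁰` bound they confine `g(x)` to a compact set of
  Lorentzian forms for which `∂₀` is timelike and `{x⁰ = const}` spacelike, hence bound the inverse
  matrix `g^{αβ}` and (with the `C²` bound, `∂(g⁻¹) = −g⁻¹ (∂g) g⁻¹`) its derivatives up to order
  2 by a constant `C(Λ)` — the requested "`C²` bounds of `Ψ^* g` and of its inverse (uniformly
  timelike `∂₀`, uniformly spacelike slabs)"; the inverse is therefore not carried as a separate
  field.

* **Sanity (non-vacuity of (ii)).** `Minkowski.hasBoundedGeometryOn_background`: Minkowski space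
  in its own global chart (`Minkowski.spacetime`, `Minkowski.background`, `Ψ` the inclusion) has
  bounded chart geometry with every constant `Λ ≥ 1` on every set — `Ψ^* η = η` is constant
  (`Minkowski.chartMetric_background_val`), `‖η‖ ≤ 1` (`Minkowski.norm_bilin_le_one`),
  `η(∂₀, ∂₀) = −1`, `η(v, v) = ‖v‖²` for `v⁰ = 0`. For (i) the corresponding statement
  (`hasBoundedGeometryOn_of_isTimeSymmetric_of_isFlat`: `k = 0` and flat `h` leave only the
  injectivity-radius clause) is proved relative to `inj ≥ Λ⁻¹`, positivity of the injectivity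
  radius not being available in the tree (`InjectivityRadius.lean`, design notes).

## Honest remark (requested by the planner; both audits of the card)

These are ASSUMPTIONS, not conclusions: nothing in this file (or in the tree) asserts that a
geodesically complete, or asymptotically flat, vacuum development — or a slice of it — has bounded
geometry at any scale. In the intended uses (the `ε`-regularity form of Anderson 2000, Thm. 0.1/0.2,
and "light + bounded geometry ⇒ dispersal" via Dong–Song 2025 and small-data theory) bounded
geometry is precisely the non-concentration hypothesis under which compactness arguments run;
curvature concentration (`Λ → ∞` along a sequence of slabs) is where a counterexample would hide,
and establishing bounded geometry of late-time slabs of complete developments is a separate,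
open, item of the route (its "NOT DECOMPOSED YET (i)").

## Design notes

* Predicates are `structure … : Prop` with named fields (hypothesis structures, CONVENTIONS §9),
  with the scale `Λ` explicit and `0 < Λ` built in (for `Λ ≤ 0` the radius clause
  `ofReal Λ⁻¹ ≤ inj` would be vacuous — a junk case an `∃ Λ` could exploit).
* (i) is stated for the data's own metric `D.metric` and Levi-Civita connection
  `D.metric.leviCivita` under the standing instance hypothesis `[D.metric.HasLeviCivita]` of
  `InitialData.lean`; the curvature clause is literally that of `CurvatureBoundedOn` (not imported:
  `CanonicalNeighbourhoods.lean` carries Ricci-flow-with-surgery material) and of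
  `CurvatureBoundedBy` (`RicciFlowMaximal.lean`, not imported either, see the next note); the
  conversion `HasBoundedGeometry.curvatureBoundedBy` to `CurvatureBoundedBy` lives in the leaf file
  `InitialDataCurvatureBound.lean`.
* Import hygiene (2026-08-17, definition item `defn-ChartMetric`): this module imports only
  `IsotropicCurvature.lean` (home of `PseudoRiemannianMetric.curvatureForm`) from the Ricci-flow
  files, and `ExponentialMap.lean` (below `InjectivityRadius.lean`) no longer imports
  `CutLocus.lean`, so that the import cone of this file — inherited by the chart-metric users
  `LateTimeOmegaLimitSet.lean`, `DeviationTolerance.lean`, `AsymptoticallyStationaryExhaustion.lean`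
  and the route files above them — carries no unproved named fact (`ricciFlow_curvature_blowup` of
  `RicciFlowMaximal.lean` and `buchner1977_cutLocus_triangulable` of `CutLocus.lean` were inherited
  before without being used).
* (ii) The `C²` clause uses the classical `iteratedFDeriv` of the extension by zero of the
  components (`chartMetricExtend`, as `deviationExtend` in `KerrConvergence.lean`); the field
  `contDiffOn` (components `C²` on the open chart domain) is what makes these derivatives honest —
  without it the derivative bounds would hold vacuously for a non-differentiable chart. One
  constant `Λ` bounds `g, ∂g, ∂²g` alike ("`C²` bounds", as requested; no scale weighting in the
  chart). Timelike/spacelike are phrased with the coordinate vector `∂₀ = E4.basisVector 0` and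
  the coordinate hyperplanes `{v⁰ = 0}` of the global chart `E4` (for the Kerr–Schild and Minkowski
  backgrounds of `KerrConvergence.lean` the background time function is `x⁰`).
* Mathlib: no bounded geometry, injectivity radius, or curvature bounds for Riemannian manifolds
  (`lean search 'BoundedGeometry|boundedGeometry|harmonicRadius'`: nothing in Mathlib; the tree
  has `injectivityRadius`, `CurvatureBoundedBy/On`, `IsKappaNoncollapsed`). Nothing here duplicates
  an existing declaration.

## References

* [Anderson2004] M. T. Anderson, *Cheeger–Gromov theory and applications to general relativity*,
  in: The Einstein equations and the large scale behavior of gravitational fields (2004),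
  347–377, arXiv:gr-qc/0208079: §1 (1.1) (scaling), Def. 2.1 (harmonic radius), Thm. 2.2,
  §5 (5.3)–(5.6), Thm. 5.1 (size conditions, `|R|_T ≤ K`, `vol B_p(1/2) ≥ v₀`).
* [Anderson2001] M. T. Anderson, *On long-time evolution in general relativity and
  geometrization of 3-manifolds*, CMP 222 (2001) 533–567, arXiv:gr-qc/0006042: (0.11),
  Rem. 1.6 (ii)–(iii), (1.22)–(1.23), (1.29)–(1.30).
* [Anderson2000] M. T. Anderson, *On stationary vacuum solutions to the Einstein equations*,
  AHP 1 (2000) 977–994: Thm. 0.2, Lemmas 1.3–1.4 ((1.9)–(1.12)).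
* [KlainermanRodnianskiSzeftel2015] S. Klainerman, I. Rodnianski, J. Szeftel, *The bounded `L²`
  curvature conjecture*, Invent. Math. 202 (2015) 91–216 = arXiv:1204.1767: Def. 2.1 (volume
  radius), Thm. 2.2, Thm. 2.10 (hypotheses `‖R‖_{L²(Σ₀)} ≤ ε`, `‖k‖_{L²} + ‖∇k‖_{L²} ≤ ε`,
  `r_vol(Σ₀, 1) ≥ 1/2`).
* [DongSong2024] C. Dong, A. Song, *Stability of Euclidean 3-space for the positive mass
  theorem*, Invent. Math. 239 (2025), arXiv:2302.07414.
* [LeeRiemannianManifolds2018] J. M. Lee, *Introduction to Riemannian Manifolds*, 2nd ed.,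
  p. 165 (injectivity radius).
-/

noncomputable section

open Bundle Set TopologicalSpace Filter
open scoped Manifold ContDiff Topology ENNReal

universe u

namespace Literature.Geometry.Lorentzian

/-! ### (i) Bounded geometry of an initial data set -/

namespace InitialDataSet

open Literature.Geometry.Riemannian (injectivityRadius globalInjectivityRadius
  le_globalInjectivityRadius_iff)

variable {E : Type*} [NormedAddCommGroup E] [NormedSpace ℝ E] {H : Type*} [TopologicalSpace H]
  {I : ModelWithCorners ℝ E H} {X : Type*} [TopologicalSpace X] [ChartedSpace H X]
  [IsManifold I ∞ X] [FiniteDimensional ℝ E]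

/-- **Bounded geometry at scale `Λ⁻¹` on `U ⊆ X`** for an initial data set `D = (h, k)`
(HYPOTHESIS structure — an assumption, never a conclusion in this tree): `0 < Λ` and at every
`x ∈ U`: the curvature of `h` is bounded, `|Rm_h(X₁,X₂,X₃,X₄)| ≤ Λ²` for `h`-unit-bounded
tangent vectors (frame form, as `Literature.Geometry.Riemannian.CurvatureBoundedOn`); the
covariant derivative of the second fundamental form is bounded, `|(∇k)(X₁,X₂,X₃)| ≤ Λ²` for
`h`-unit-bounded vectors (`∇k = D.metric.covDeriv₂ D.k`, derivative slot last); `|k|²_h ≤ Λ²`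
(`D.normSqK`); and the injectivity radius of `h` satisfies `inj(x) ≥ Λ⁻¹`
(`Literature.Geometry.Riemannian.injectivityRadius`, an extended real). Up to a factor `3` and
dimensional constants this is "`|Riem_h| + |∇k| + |k|²_h ≤ Λ²` pointwise on `U` and `inj_h ≥ Λ⁻¹`
on `U`", the scale-`Λ⁻¹` non-collapsed curvature bound of Cheeger–Gromov theory for the pair
`(h, k)`: for a slice of a vacuum spacetime the Gauss–Codazzi equations turn the three bounds
into Anderson's frame bound `|R|_T ≤ C Λ²` on the space-time curvature along the slice
(Anderson 2004, §5, (5.3) and (5.5), with the non-collapsing `vol B_p(1/2) ≥ v₀` of (5.5)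
replaced by the injectivity radius — equivalent under the curvature bound, Anderson 2001,
Rem. 1.6 (ii); Riemannian prototype Anderson 2004, Thm. 2.2, `|Ric| ≤ k, inj ≥ i₀`; Anderson
2000, (1.9)–(1.10)), plus control of the extrinsic curvature `k` of the slice; the `L²` version
of the same triple (`‖R‖_{L²}`, `‖k‖_{L²} + ‖∇k‖_{L²}`, volume radius at scale `1`) is the
hypothesis of Klainerman–Rodnianski–Szeftel, arXiv:1204.1767, Thm. 2.10. The harmonic-radius
form is not vendored (no harmonic coordinates in the tree); see the module docstring.
[cite: Anderson2004, §5 (5.3)–(5.5) and §2 Thm. 2.2] -/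
structure HasBoundedGeometryOn (D : InitialDataSet I X) [D.metric.HasLeviCivita] (U : Set X)
    (Λ : ℝ) : Prop where
  /-- The scale parameter is positive. -/
  pos : 0 < Λ
  /-- `|Rm_h| ≤ Λ²` on `U`, frame-wise. -/
  abs_curvatureForm_le : ∀ x ∈ U, ∀ X₁ X₂ X₃ X₄ : TangentSpace I x,
    D.metric.val x X₁ X₁ ≤ 1 → D.metric.val x X₂ X₂ ≤ 1 → D.metric.val x X₃ X₃ ≤ 1 →
      D.metric.val x X₄ X₄ ≤ 1 →
        |D.metric.curvatureForm D.metric.leviCivita x X₁ X₂ X₃ X₄| ≤ Λ ^ 2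
  /-- `|∇k| ≤ Λ²` on `U`, frame-wise (`covDeriv₂ k x X₁ X₂ X₃ = (∇_{X₃} k)(X₁, X₂)`). -/
  abs_covDeriv₂_le : ∀ x ∈ U, ∀ X₁ X₂ X₃ : TangentSpace I x,
    D.metric.val x X₁ X₁ ≤ 1 → D.metric.val x X₂ X₂ ≤ 1 → D.metric.val x X₃ X₃ ≤ 1 →
      |D.metric.covDeriv₂ D.k x X₁ X₂ X₃| ≤ Λ ^ 2
  /-- `|k|²_h ≤ Λ²` on `U`. -/
  normSqK_le : ∀ x ∈ U, D.normSqK x ≤ Λ ^ 2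
  /-- `inj_h(x) ≥ Λ⁻¹` on `U`. -/
  le_injectivityRadius : ∀ x ∈ U, ENNReal.ofReal Λ⁻¹ ≤ injectivityRadius D.metric x

/-- **Bounded geometry at scale `Λ⁻¹`** (everywhere) for an initial data set `D = (h, k)`:
`HasBoundedGeometryOn D univ Λ` — `|Rm_h|, |∇k|, |k|²_h ≤ Λ²` pointwise (frame-wise / `h`-trace
norms) and `inj_h ≥ Λ⁻¹` at every point (HYPOTHESIS structure; Anderson 2004, §2, Thm. 2.2 and
§5, (5.5); Anderson 2001, Rem. 1.6 (ii); Anderson 2000, (1.9)–(1.10)).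
[cite: Anderson2004, §2 Thm. 2.2 and §5 (5.5)] -/
def HasBoundedGeometry (D : InitialDataSet I X) [D.metric.HasLeviCivita] (Λ : ℝ) : Prop :=
  D.HasBoundedGeometryOn univ Λ

variable {D : InitialDataSet I X} [D.metric.HasLeviCivita]

/-- Unfolding: bounded geometry everywhere is bounded geometry on `univ`. [folklore] -/
theorem hasBoundedGeometryOn_univ_iff {Λ : ℝ} :
    D.HasBoundedGeometryOn univ Λ ↔ D.HasBoundedGeometry Λ :=
  Iff.rfl

/-- **Monotonicity**: bounded geometry at scale `Λ⁻¹` on `V` gives bounded geometry at every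
coarser scale `Λ'⁻¹ ≤ Λ⁻¹` on every `U ⊆ V` (all four clauses weaken as `Λ` grows).
[folklore] -/
theorem HasBoundedGeometryOn.mono {U V : Set X} {Λ Λ' : ℝ} (h : D.HasBoundedGeometryOn V Λ)
    (hUV : U ⊆ V) (hΛ : Λ ≤ Λ') : D.HasBoundedGeometryOn U Λ' := by
  have hsq : Λ ^ 2 ≤ Λ' ^ 2 := by
    have := h.pos.le
    gcongr
  have hinv : ENNReal.ofReal Λ'⁻¹ ≤ ENNReal.ofReal Λ⁻¹ :=
    ENNReal.ofReal_le_ofReal (inv_anti₀ h.pos hΛ)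
  exact
    { pos := h.pos.trans_le hΛ
      abs_curvatureForm_le := fun x hx X₁ X₂ X₃ X₄ h₁ h₂ h₃ h₄ ↦
        (h.abs_curvatureForm_le x (hUV hx) X₁ X₂ X₃ X₄ h₁ h₂ h₃ h₄).trans hsq
      abs_covDeriv₂_le := fun x hx X₁ X₂ X₃ h₁ h₂ h₃ ↦
        (h.abs_covDeriv₂_le x (hUV hx) X₁ X₂ X₃ h₁ h₂ h₃).trans hsq
      normSqK_le := fun x hx ↦ (h.normSqK_le x (hUV hx)).trans hsq
      le_injectivityRadius := fun x hx ↦ hinv.trans (h.le_injectivityRadius x (hUV hx)) }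

/-- Bounded geometry everywhere restricts to bounded geometry on every set. [folklore] -/
theorem HasBoundedGeometry.on {Λ : ℝ} (h : D.HasBoundedGeometry Λ) (U : Set X) :
    D.HasBoundedGeometryOn U Λ :=
  HasBoundedGeometryOn.mono h (subset_univ U) le_rfl

/-- Bounded geometry at scale `Λ⁻¹` persists at every coarser scale `Λ'⁻¹`, `Λ ≤ Λ'`.
[folklore] -/
theorem HasBoundedGeometry.mono {Λ Λ' : ℝ} (h : D.HasBoundedGeometry Λ) (hΛ : Λ ≤ Λ') :
    D.HasBoundedGeometry Λ' :=
  HasBoundedGeometryOn.mono h subset_rfl hΛ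

/-- Under bounded geometry at scale `Λ⁻¹` the injectivity radius of `(X, h)` is at least `Λ⁻¹`:
`inj(X, h) ≥ Λ⁻¹` (Lee 2018, p. 165, `inj(M) = inf_p inj(p)`). [folklore] -/
theorem HasBoundedGeometry.le_globalInjectivityRadius {Λ : ℝ} (h : D.HasBoundedGeometry Λ) :
    ENNReal.ofReal Λ⁻¹ ≤ globalInjectivityRadius D.metric :=
  le_globalInjectivityRadius_iff.2 fun x ↦ h.le_injectivityRadius x (mem_univ x)

/-- Under bounded geometry at scale `Λ⁻¹`, `|k|²_h ≤ Λ²` at every point. [folklore] -/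
theorem HasBoundedGeometry.normSqK_le_sq {Λ : ℝ} (h : D.HasBoundedGeometry Λ) (x : X) :
    D.normSqK x ≤ Λ ^ 2 :=
  h.normSqK_le x (mem_univ x)

/-- **Time-symmetric data with flat metric**: if `k = 0` and the Levi-Civita connection of `h` is
flat, the three curvature-type clauses hold at every scale, so `D` has bounded geometry at scale
`Λ⁻¹` on `U` as soon as `inj_h ≥ Λ⁻¹` on `U` (e.g. Euclidean `ℝ³` with `k = 0` at every scale,
Lee 2018, p. 165: `inj(ℝⁿ) = ∞`). [folklore] -/
theorem hasBoundedGeometryOn_of_isTimeSymmetric_of_isFlat {U : Set X} {Λ : ℝ}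
    (hk : D.IsTimeSymmetric) (hflat : D.metric.leviCivita.IsFlat) (hΛ : 0 < Λ)
    (hinj : ∀ x ∈ U, ENNReal.ofReal Λ⁻¹ ≤ injectivityRadius D.metric x) :
    D.HasBoundedGeometryOn U Λ where
  pos := hΛ
  abs_curvatureForm_le x _ X₁ X₂ X₃ X₄ _ _ _ _ := by
    have h0 : D.metric.curvatureForm D.metric.leviCivita x X₁ X₂ X₃ X₄ = 0 := by
      simp [PseudoRiemannianMetric.curvatureForm, (D.metric.leviCivita.isFlat_iff).1 hflat]
    rw [h0, abs_zero]
    positivity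
  abs_covDeriv₂_le x _ X₁ X₂ X₃ _ _ _ := by
    have hk0 : D.k = fun _ ↦ 0 := funext hk
    rw [hk0, PseudoRiemannianMetric.covDeriv₂_zero]
    simpa using sq_nonneg Λ
  normSqK_le x _ := by
    rw [hk.normSqK_eq_zero x]
    positivity
  le_injectivityRadius := hinj

end InitialDataSet

/-! ### (ii) Bounded geometry of a spacetime slab in a late-time chart -/

namespace ModelBackground

/-- The **truncated time band** `{x ∈ U | τ ≤ t(x) ≤ τ + L, r(x) ≤ R}` of a reference background:
the slab of coordinate-time length `L` after time `τ`, cut off at radius `R` (the region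
`{τ ≤ x⁰ ≤ τ + L} ∩ {r ≤ R}` on which slab bounded geometry is imposed; compare
`truncTimeSlab R τ = {t = τ, r ≤ R}` and `truncLateRegion τ₁ R`). DHRT arXiv:2104.08222, §1
(near region `{r ≤ R}` of the `t*`-foliation). [cite: arXiv210408222, §1] -/
def truncTimeBand (B : ModelBackground) (τ L R : ℝ) : Set B.domain :=
  {x | τ ≤ B.time x.1 ∧ B.time x.1 ≤ τ + L ∧ B.radius x.1 ≤ R}

/-- Membership in a truncated time band. [folklore] -/
@[simp]
theorem mem_truncTimeBand {B : ModelBackground} {τ L R : ℝ} {x : B.domain} :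
    x ∈ B.truncTimeBand τ L R ↔ τ ≤ B.time x.1 ∧ B.time x.1 ≤ τ + L ∧ B.radius x.1 ≤ R :=
  Iff.rfl

/-- The truncated slabs `{t = τ', r ≤ R}`, `τ ≤ τ' ≤ τ + L`, lie in the band. [folklore] -/
theorem truncTimeSlab_subset_truncTimeBand (B : ModelBackground) {τ L R τ' : ℝ} (h₁ : τ ≤ τ')
    (h₂ : τ' ≤ τ + L) : B.truncTimeSlab R τ' ⊆ B.truncTimeBand τ L R :=
  fun _ hx ↦ ⟨hx.1 ▸ h₁, hx.1 ▸ h₂, hx.2⟩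

/-- Truncated time bands are monotone in the length `L` and the radius `R`. [folklore] -/
theorem truncTimeBand_mono (B : ModelBackground) (τ : ℝ) {L L' R R' : ℝ} (hL : L ≤ L')
    (hR : R ≤ R') : B.truncTimeBand τ L R ⊆ B.truncTimeBand τ L' R' :=
  fun _ hx ↦ ⟨hx.1, hx.2.1.trans (by linarith), hx.2.2.trans hR⟩

/-- A band after time `τ > τ₀` lies in the late region `{t > τ₀}`. [folklore] -/
theorem truncTimeBand_subset_lateRegion (B : ModelBackground) {τ₀ τ : ℝ} (h : τ₀ < τ)
    (L R : ℝ) : B.truncTimeBand τ L R ⊆ B.lateRegion τ₀ :=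
  fun _ hx ↦ lt_of_lt_of_le h hx.1

end ModelBackground

namespace Spacetime

variable (𝓢 : Spacetime.{u} 4) (B : ModelBackground)

/-- The **pulled-back metric in the chart**, `(Ψ^* g)(x) : E4 →L[ℝ] E4 →L[ℝ] ℝ` at `x ∈ U`: the
components `g_{αβ}(x) = g(dΨ ∂_α, dΨ ∂_β)` of the spacetime metric `g = 𝓢.metric` in the chart
`Ψ : U → 𝓢.carrier` (`pullbackBilin`; the tangent space of the open submanifold `U ⊆ E4` is `E4`
definitionally). The metric deviation of `KerrConvergence.lean` is `Ψ^* g − g₀`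
(`deviation_eq_chartMetric_sub`). O'Neill 1983, Ch. 3, Def. 3.9 (pullback); Anderson 2004, §5
(the space-time components `g_{αβ}` in a chart). [cite: Anderson2004, §5, (5.6)] -/
def chartMetric (Ψ : B.domain → 𝓢.carrier) (x : B.domain) : E4 →L[ℝ] E4 →L[ℝ] ℝ :=
  show E4 →L[ℝ] E4 →L[ℝ] ℝ from pullbackBilin (I := 𝓡 4) (I' := 𝓘(ℝ, E4)) Ψ 𝓢.metric.val x

/-- Unfolding lemma: `(Ψ^* g)(x)(v, w) = g_{Ψ x}(dΨ_x v, dΨ_x w)`. [folklore] -/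
theorem chartMetric_apply (Ψ : B.domain → 𝓢.carrier) (x : B.domain) (v w : E4) :
    𝓢.chartMetric B Ψ x v w =
      𝓢.metric.val (Ψ x) (mfderiv 𝓘(ℝ, E4) (𝓡 4) Ψ x v) (mfderiv 𝓘(ℝ, E4) (𝓡 4) Ψ x w) :=
  rfl

/-- `(Ψ^* g)(x)` is symmetric (the spacetime metric is). [folklore] -/
theorem chartMetric_symm (Ψ : B.domain → 𝓢.carrier) (x : B.domain) (v w : E4) :
    𝓢.chartMetric B Ψ x v w = 𝓢.chartMetric B Ψ x w v := by
  rw [chartMetric_apply, chartMetric_apply, 𝓢.metric.symm]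

/-- The metric deviation of `KerrConvergence.lean` is `Ψ^* g − g₀`:
`𝓢.deviation B Ψ x = 𝓢.chartMetric B Ψ x − B.bilin x` (definitionally). DHRT arXiv:2104.08222,
§1. [folklore] -/
theorem deviation_eq_chartMetric_sub (Ψ : B.domain → 𝓢.carrier) (x : B.domain) :
    𝓢.deviation B Ψ x = 𝓢.chartMetric B Ψ x - B.bilin x.1 :=
  rfl

/-- The chart metric extended by zero to all of `E4` (`Function.extend Subtype.val · 0`, as
`deviationExtend`), so that Mathlib's `iteratedFDeriv ℝ m` applies; on the open set `U` its
derivatives are the coordinate derivatives `∂^m g_{αβ}`. Anderson 2004, §5, (5.6).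
[cite: Anderson2004, §5, (5.6)] -/
def chartMetricExtend (Ψ : B.domain → 𝓢.carrier) : E4 → E4 →L[ℝ] E4 →L[ℝ] ℝ :=
  Function.extend Subtype.val (𝓢.chartMetric B Ψ) 0

/-- On the domain, the extension agrees with the chart metric. [folklore] -/
@[simp]
theorem chartMetricExtend_coe (Ψ : B.domain → 𝓢.carrier) (x : B.domain) :
    𝓢.chartMetricExtend B Ψ x = 𝓢.chartMetric B Ψ x :=
  Subtype.val_injective.extend_apply _ _ x

/-- Off the domain, the extension is the junk value `0` (never used). [folklore] -/
theorem chartMetricExtend_of_not_mem (Ψ : B.domain → 𝓢.carrier) {y : E4} (hy : y ∉ B.domain) :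
    𝓢.chartMetricExtend B Ψ y = 0 := by
  rw [chartMetricExtend, Function.extend_apply']
  · rfl
  · rintro ⟨x, rfl⟩
    exact hy x.2

/-- The extended deviation is the extended chart metric minus the extended background:
on the domain `deviationExtend = chartMetricExtend − g₀`. [folklore] -/
theorem deviationExtend_coe_eq (Ψ : B.domain → 𝓢.carrier) (x : B.domain) :
    𝓢.deviationExtend B Ψ x = 𝓢.chartMetricExtend B Ψ x - B.bilin x.1 := by
  rw [deviationExtend_coe, chartMetricExtend_coe, deviation_eq_chartMetric_sub]

/-- The **`Cᵏ` size of the chart metric over `S ⊆ U`**: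
`sup_{m ≤ k} sup_{x ∈ S} ‖∂^m (Ψ^* g)(x)‖ ∈ [0, ∞]` (`supCkENorm` of the extension by zero; only
charts whose components are `Cᵏ` on the open domain are intended, cf.
`HasBoundedGeometryOn.contDiffOn`). Anderson 2004, §5, (5.6) (`‖g_{αβ}‖` with derivatives up to
order 2, there in `L^{2,p}`, here in sup norm). [cite: Anderson2004, §5, (5.6)] -/
def chartMetricCk (Ψ : B.domain → 𝓢.carrier) (k : ℕ) (S : Set B.domain) : ℝ≥0∞ :=
  supCkENorm (Subtype.val '' S) k (𝓢.chartMetricExtend B Ψ)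

/-- `chartMetricCk` is monotone in the set. [folklore] -/
theorem chartMetricCk_mono (Ψ : B.domain → 𝓢.carrier) (k : ℕ) {S T : Set B.domain}
    (h : S ⊆ T) : 𝓢.chartMetricCk B Ψ k S ≤ 𝓢.chartMetricCk B Ψ k T :=
  supCkENorm_mono (image_mono h) _ _

/-- `chartMetricCk` is monotone in the order `k`. [folklore] -/
theorem chartMetricCk_mono_right (Ψ : B.domain → 𝓢.carrier) {k k' : ℕ} (h : k ≤ k')
    (S : Set B.domain) : 𝓢.chartMetricCk B Ψ k S ≤ 𝓢.chartMetricCk B Ψ k' S :=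
  supCkENorm_mono_right _ h _

/-- **Bounded geometry (with constant `Λ`) of the chart `Ψ` on `S ⊆ U`** (HYPOTHESIS structure —
an assumption, never a conclusion in this tree): the coordinate face of bounded geometry for a
spacetime region covered by one chart `Ψ : U → 𝓢.carrier` modelled on the reference background
`B` (Anderson 2004, Def. 2.1 and §5, (5.3)–(5.6), Thm. 5.1: control of the full space-time
components `g_{αβ}` and their derivatives up to order `2` in a chart of definite size, the size
of tensors being measured against a unit timelike direction). Clauses: `0 < Λ`; the components
`Ψ^* g` are `C²` on the open chart domain `U ⊆ E4` (so that the classical derivatives below are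
honest); **`C²` bound** `‖∂^m (Ψ^* g)(x)‖ ≤ Λ` for `m ≤ 2`, `x ∈ S` (`chartMetricCk … 2 S ≤ Λ`);
**`∂₀` uniformly timelike**, `(Ψ^* g)(x)(∂₀, ∂₀) ≤ −Λ⁻¹`; **coordinate slices `{x⁰ = const}`
uniformly spacelike**, `(Ψ^* g)(x)(v, v) ≥ Λ⁻¹ ‖v‖²` for all `v` with `v⁰ = 0`. The last two
clauses are the Lorentzian replacement of `c₀⁻¹ δ ≤ g_{αβ} ≤ c₀ δ` of Def. 2.1: with the `C⁰`
bound they bound the inverse components `g^{αβ}` (and, with the `C²` bound, their derivatives up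
to order `2`) by a constant depending only on `Λ`, which is why "`C²` bounds of the inverse" is
not a separate field. All clauses weaken as `Λ` grows (`HasBoundedGeometryOn.mono`).
[cite: Anderson2004, Def. 2.1 and §5 (5.3)–(5.6), Thm. 5.1] -/
structure HasBoundedGeometryOn (Ψ : B.domain → 𝓢.carrier) (S : Set B.domain) (Λ : ℝ) :
    Prop where
  /-- The constant is positive. -/
  pos : 0 < Λ
  /-- The components `Ψ^* g` are `C²` on the (open) chart domain. -/
  contDiffOn : ContDiffOn ℝ 2 (𝓢.chartMetricExtend B Ψ) (B.domain : Set E4)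
  /-- `‖∂^m (Ψ^* g)‖ ≤ Λ` on `S` for `m ≤ 2`. -/
  chartMetricCk_le : 𝓢.chartMetricCk B Ψ 2 S ≤ ENNReal.ofReal Λ
  /-- `∂₀` is uniformly timelike on `S`: `g₀₀ ≤ −Λ⁻¹`. -/
  timelike : ∀ x ∈ S, 𝓢.chartMetric B Ψ x (E4.basisVector 0) (E4.basisVector 0) ≤ -Λ⁻¹
  /-- The coordinate slices are uniformly spacelike on `S`: `g(v, v) ≥ Λ⁻¹ ‖v‖²` for `v⁰ = 0`. -/
  spacelike : ∀ x ∈ S, ∀ v : E4, v 0 = 0 → Λ⁻¹ * ‖v‖ ^ 2 ≤ 𝓢.chartMetric B Ψ x v v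

/-- **Bounded geometry (with constant `Λ`) of the spacetime slab
`{τ ≤ t ≤ τ + L} ∩ {r ≤ R}` in the late-time chart `Ψ`**: `HasBoundedGeometryOn` on the
truncated time band `B.truncTimeBand τ L R` — `C²` bounds of `Ψ^* g` by `Λ`, `∂₀` uniformly
timelike and the slices uniformly spacelike (hence `C²` bounds of the inverse), on the slab
(HYPOTHESIS structure; Anderson 2004, §5, Thm. 5.1 with (5.4)–(5.6): `g_{αβ}` controlled up to
order `2` on cylinders `B_p(r₀) × [−r₀, r₀]`). [cite: Anderson2004, §5 Thm. 5.1, (5.4)–(5.6)] -/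
def HasBoundedSlabGeometry (Ψ : B.domain → 𝓢.carrier) (τ L R Λ : ℝ) : Prop :=
  𝓢.HasBoundedGeometryOn B Ψ (B.truncTimeBand τ L R) Λ

variable {𝓢 B}

/-- Unfolding of `HasBoundedSlabGeometry`. [folklore] -/
theorem hasBoundedSlabGeometry_iff {Ψ : B.domain → 𝓢.carrier} {τ L R Λ : ℝ} :
    𝓢.HasBoundedSlabGeometry B Ψ τ L R Λ ↔
      𝓢.HasBoundedGeometryOn B Ψ (B.truncTimeBand τ L R) Λ :=
  Iff.rfl

/-- **Monotonicity**: bounded chart geometry with constant `Λ` on `T` gives bounded chart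
geometry with every constant `Λ' ≥ Λ` on every `S ⊆ T`. [folklore] -/
theorem HasBoundedGeometryOn.mono {Ψ : B.domain → 𝓢.carrier} {S T : Set B.domain} {Λ Λ' : ℝ}
    (h : 𝓢.HasBoundedGeometryOn B Ψ T Λ) (hST : S ⊆ T) (hΛ : Λ ≤ Λ') :
    𝓢.HasBoundedGeometryOn B Ψ S Λ' := by
  have hinv : Λ'⁻¹ ≤ Λ⁻¹ := inv_anti₀ h.pos hΛ
  exact
    { pos := h.pos.trans_le hΛ
      contDiffOn := h.contDiffOn
      chartMetricCk_le := ((𝓢.chartMetricCk_mono B Ψ 2 hST).trans h.chartMetricCk_le).trans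
        (ENNReal.ofReal_le_ofReal hΛ)
      timelike := fun x hx ↦ (h.timelike x (hST hx)).trans (neg_le_neg hinv)
      spacelike := fun x hx v hv ↦
        (mul_le_mul_of_nonneg_right hinv (sq_nonneg _)).trans (h.spacelike x (hST hx) v hv) }

-- the operator-norm instance on `E4 →L[ℝ] E4 →L[ℝ] ℝ` needs one more level of pending
-- instance problems than the default (as in `Riemannian/CurvatureNormSq.lean`)
set_option maxSynthPendingDepth 3 in
/-- Pointwise size of the components under bounded chart geometry: `‖(Ψ^* g)(x)‖ ≤ Λ` on `S`
(operator norm). [folklore] -/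
theorem HasBoundedGeometryOn.norm_chartMetric_le {Ψ : B.domain → 𝓢.carrier} {S : Set B.domain}
    {Λ : ℝ} (h : 𝓢.HasBoundedGeometryOn B Ψ S Λ) {x : B.domain} (hx : x ∈ S) :
    ‖𝓢.chartMetric B Ψ x‖ ≤ Λ := by
  have h' := (enorm_iteratedFDeriv_le_supCkENorm (Nat.zero_le 2) (mem_image_of_mem Subtype.val hx)
    (𝓢.chartMetricExtend B Ψ)).trans h.chartMetricCk_le
  rw [← ofReal_norm, ENNReal.ofReal_le_ofReal_iff h.pos.le, norm_iteratedFDeriv_zero,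
    chartMetricExtend_coe] at h'
  exact h'

/-- Under bounded chart geometry `∂₀` is timelike for `Ψ^* g` at every point of `S`:
`(Ψ^* g)(∂₀, ∂₀) < 0`. [folklore] -/
theorem HasBoundedGeometryOn.chartMetric_basisVector_zero_neg {Ψ : B.domain → 𝓢.carrier}
    {S : Set B.domain} {Λ : ℝ} (h : 𝓢.HasBoundedGeometryOn B Ψ S Λ) {x : B.domain} (hx : x ∈ S) :
    𝓢.chartMetric B Ψ x (E4.basisVector 0) (E4.basisVector 0) < 0 :=
  (h.timelike x hx).trans_lt (neg_neg_of_pos (inv_pos.2 h.pos))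

/-- Under bounded chart geometry the non-zero vectors tangent to the coordinate slices are
spacelike for `Ψ^* g` at every point of `S`: `(Ψ^* g)(v, v) > 0` for `v ≠ 0`, `v⁰ = 0`.
[folklore] -/
theorem HasBoundedGeometryOn.chartMetric_pos {Ψ : B.domain → 𝓢.carrier} {S : Set B.domain}
    {Λ : ℝ} (h : 𝓢.HasBoundedGeometryOn B Ψ S Λ) {x : B.domain} (hx : x ∈ S) {v : E4}
    (hv : v 0 = 0) (hv0 : v ≠ 0) : 0 < 𝓢.chartMetric B Ψ x v v :=
  (mul_pos (inv_pos.2 h.pos) (pow_pos (norm_pos_iff.2 hv0) 2)).trans_le (h.spacelike x hx v hv)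

/-- Slab bounded geometry is monotone: smaller slab (`L' ≤ L`, `R' ≤ R`, same `τ`) and larger
constant. [folklore] -/
theorem HasBoundedSlabGeometry.mono {Ψ : B.domain → 𝓢.carrier} {τ L L' R R' Λ Λ' : ℝ}
    (h : 𝓢.HasBoundedSlabGeometry B Ψ τ L R Λ) (hL : L' ≤ L) (hR : R' ≤ R) (hΛ : Λ ≤ Λ') :
    𝓢.HasBoundedSlabGeometry B Ψ τ L' R' Λ' :=
  HasBoundedGeometryOn.mono h (B.truncTimeBand_mono τ hL hR) hΛ

/-- Slab bounded geometry controls every truncated time slab `{t = τ', r ≤ R}` inside the band,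
`τ ≤ τ' ≤ τ + L` (the sets over which `truncDeviationCk` of `KerrConvergence.lean` is taken).
[folklore] -/
theorem HasBoundedSlabGeometry.on_truncTimeSlab {Ψ : B.domain → 𝓢.carrier} {τ L R Λ τ' : ℝ}
    (h : 𝓢.HasBoundedSlabGeometry B Ψ τ L R Λ) (h₁ : τ ≤ τ') (h₂ : τ' ≤ τ + L) :
    𝓢.HasBoundedGeometryOn B Ψ (B.truncTimeSlab R τ') Λ :=
  HasBoundedGeometryOn.mono h (B.truncTimeSlab_subset_truncTimeBand h₁ h₂) le_rfl

end Spacetime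

/-! ### Sanity: Minkowski space in its own global chart -/

section MinkowskiSanity

set_option maxSynthPendingDepth 3 in
/-- The `Cᵏ` sup norm of a constant map is at most the norm of the constant (all derivatives of
positive order vanish). [folklore] -/
theorem supCkENorm_const_le {F G : Type*} [NormedAddCommGroup F] [NormedSpace ℝ F]
    [NormedAddCommGroup G] [NormedSpace ℝ G] (S : Set F) (k : ℕ) (c : G) :
    supCkENorm S k (fun _ : F ↦ c) ≤ ‖c‖ₑ := by
  refine iSup₂_le fun m _ ↦ iSup₂_le fun y _ ↦ ?_
  rcases Nat.eq_zero_or_pos m with rfl | hm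
  · rw [← ofReal_norm, norm_iteratedFDeriv_zero, ofReal_norm]
  · rw [iteratedFDeriv_const_of_ne (Nat.pos_iff_ne_zero.1 hm)]
    simp

/-- `|η(v, w)| ≤ ‖v‖ ‖w‖` for the Minkowski form on `E4` (Cauchy–Schwarz for the vectors of
absolute values of the components). [folklore] -/
theorem Minkowski.abs_bilin_le (v w : E4) : |Minkowski.bilin v w| ≤ ‖v‖ * ‖w‖ := by
  rw [Minkowski.bilin_apply]
  have key : |-(v 0 * w 0) + ∑ i : Fin 3, v i.succ * w i.succ| ≤ ∑ μ : Fin 4, |v μ| * |w μ| := by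
    calc |-(v 0 * w 0) + ∑ i : Fin 3, v i.succ * w i.succ|
        ≤ |-(v 0 * w 0)| + |∑ i : Fin 3, v i.succ * w i.succ| := abs_add_le _ _
      _ ≤ |v 0| * |w 0| + ∑ i : Fin 3, |v i.succ| * |w i.succ| := by
          gcongr
          · rw [abs_neg, abs_mul]
          · exact (Finset.abs_sum_le_sum_abs _ _).trans (le_of_eq (by simp [abs_mul]))
      _ = ∑ μ : Fin 4, |v μ| * |w μ| := by
          conv_rhs => rw [Fin.sum_univ_succ]
  refine key.trans ?_
  have hcs := Finset.sum_mul_sq_le_sq_mul_sq Finset.univ (fun μ : Fin 4 ↦ |v μ|) (fun μ ↦ |w μ|)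
  have hv : ∑ μ : Fin 4, |v μ| ^ 2 = ‖v‖ ^ 2 := by
    rw [EuclideanSpace.real_norm_sq_eq]; simp [sq_abs]
  have hw : ∑ μ : Fin 4, |w μ| ^ 2 = ‖w‖ ^ 2 := by
    rw [EuclideanSpace.real_norm_sq_eq]; simp [sq_abs]
  rw [hv, hw] at hcs
  have hnn : 0 ≤ ∑ μ : Fin 4, |v μ| * |w μ| := Finset.sum_nonneg fun μ _ ↦ by positivity
  nlinarith [norm_nonneg v, norm_nonneg w, mul_nonneg (norm_nonneg v) (norm_nonneg w)]

set_option maxSynthPendingDepth 3 in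
/-- `‖η‖ ≤ 1` in the operator norm of `E4 →L[ℝ] E4 →L[ℝ] ℝ`. [folklore] -/
theorem Minkowski.norm_bilin_le_one : ‖Minkowski.bilin‖ ≤ 1 :=
  ContinuousLinearMap.opNorm_le_bound₂ _ zero_le_one fun v w ↦ by
    rw [Real.norm_eq_abs, one_mul]; exact Minkowski.abs_bilin_le v w

/-- **The chart metric of Minkowski space in its own global chart is `η`**: for
`𝓢 = Minkowski.spacetime`, `B = Minkowski.background` (domain all of `E4`) and `Ψ` the inclusion,
`Ψ^* η = η` (the inclusion of an open submanifold has identity differential,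
`mfderiv_subtypeVal`). [folklore] -/
theorem Minkowski.chartMetric_background_val (x : Minkowski.background.domain) :
    Minkowski.spacetime.chartMetric Minkowski.background
      (Subtype.val : Minkowski.background.domain → E4) x = Minkowski.bilin := by
  ext v w
  rw [Spacetime.chartMetric_apply]
  have h := mfderiv_subtypeVal (I' := 𝓡 4) (W := Minkowski.background.domain) x
  erw [h]
  rfl

/-- In the global chart of Minkowski space the extended chart metric is the constant `η`
(the chart domain is all of `E4`, so no junk values occur). [folklore] -/
theorem Minkowski.chartMetricExtend_background_val (y : E4) :
    Minkowski.spacetime.chartMetricExtend Minkowski.background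
      (Subtype.val : Minkowski.background.domain → E4) y = Minkowski.bilin := by
  have h := Spacetime.chartMetricExtend_coe Minkowski.spacetime Minkowski.background
    (Subtype.val : Minkowski.background.domain → E4) ⟨y, trivial⟩
  rwa [Minkowski.chartMetric_background_val] at h

set_option maxSynthPendingDepth 3 in
/-- **Non-vacuity / sanity**: Minkowski space in its own global chart has bounded chart geometry
with every constant `Λ ≥ 1` on every set `S` (in particular bounded slab geometry on every slab):
`η` is constant with `‖η‖ ≤ 1`, `η(∂₀, ∂₀) = −1 ≤ −Λ⁻¹` and `η(v, v) = ‖v‖² ≥ Λ⁻¹ ‖v‖²` for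
`v⁰ = 0`. (The threshold `Λ ≥ 1` is sharp for the cone clauses.) [folklore] -/
theorem Minkowski.hasBoundedGeometryOn_background (S : Set Minkowski.background.domain) {Λ : ℝ}
    (hΛ : 1 ≤ Λ) :
    Minkowski.spacetime.HasBoundedGeometryOn Minkowski.background
      (Subtype.val : Minkowski.background.domain → E4) S Λ := by
  have hΛ0 : 0 < Λ := one_pos.trans_le hΛ
  have hinv : Λ⁻¹ ≤ 1 := inv_le_one_of_one_le₀ hΛ
  have hconst : Minkowski.spacetime.chartMetricExtend Minkowski.background
      (Subtype.val : Minkowski.background.domain → E4) = fun _ ↦ Minkowski.bilin :=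
    funext Minkowski.chartMetricExtend_background_val
  refine ⟨hΛ0, ?_, ?_, ?_, ?_⟩
  · rw [hconst]; exact contDiffOn_const
  · unfold Spacetime.chartMetricCk
    rw [hconst]
    refine (supCkENorm_const_le _ _ _).trans ?_
    rw [← ofReal_norm]
    exact ENNReal.ofReal_le_ofReal (Minkowski.norm_bilin_le_one.trans hΛ)
  · intro x _
    rw [Minkowski.chartMetric_background_val, Minkowski.bilin_basisVector_zero]
    exact neg_le_neg hinv
  · intro x _ v hv
    rw [Minkowski.chartMetric_background_val, Minkowski.bilin_apply, hv]
    have hnorm : ‖v‖ ^ 2 = ∑ i : Fin 3, v i.succ * v i.succ := by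
      rw [EuclideanSpace.real_norm_sq_eq, Fin.sum_univ_succ, hv]
      simp [sq]
    rw [hnorm]
    have hnn : 0 ≤ ∑ i : Fin 3, v i.succ * v i.succ :=
      Finset.sum_nonneg fun i _ ↦ mul_self_nonneg _
    nlinarith

/-- Minkowski space has bounded slab geometry with every constant `Λ ≥ 1` on every slab
`{τ ≤ x⁰ ≤ τ + L} ∩ {r ≤ R}` of its global chart. [folklore] -/
theorem Minkowski.hasBoundedSlabGeometry_background (τ L R : ℝ) {Λ : ℝ} (hΛ : 1 ≤ Λ) :
    Minkowski.spacetime.HasBoundedSlabGeometry Minkowski.background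
      (Subtype.val : Minkowski.background.domain → E4) τ L R Λ :=
  Minkowski.hasBoundedGeometryOn_background _ hΛ

end MinkowskiSanity


end Literature.Geometry.Lorentzian

end
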